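import Summits.AtomisticToContinuum.Crystallization.Theorems.OverbindingBudgetAffineCompressedCutEstablish
import Summits.AtomisticToContinuum.Crystallization.Theorems.OverbindingBudgetAffineRunCutSheetLetterA
import Summits.AtomisticToContinuum.Crystallization.Theorems.OverbindingBudgetAffineRunCutCrossRound

/-!
# `OverbindingBudget` / crux `RobustDefectLimitWindows` (stmt-AtomisticToContinuum-31280) — «RunCut»: LETTER CONSTANCY ALONG BASAL BONDS («SheetLetter», part B)

Support file (lens-4 g88, part 16B; memo `g87/memo/SW-CHI.md` §10.8 «reach audit + letter-constancy mechanism», critic row 1574 (B)(i): the ANNULUS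
SHEET-COMPLETENESS ENGINE of the uniaxial-core lemma).  Leaf SW♭ = `…OverbindingBudgetAffineRunCutFlat.StackSwapGainFlatWide`.

THE STATEMENT (`basal_step_record`; user forms `basal_step_hcp` / `basal_step_back` / `basal_step_axis` / `basal_step_scale`).  Pointwise affine chart data
at the leaf's literals `(η, θ, g) = (10⁻⁴, 10⁻³, 1/450)` — at `m` the hcp two-shell pattern matched through an affine frame `A` that is `θ`-close to a linear
isometry `Q` on the pattern (radius `η ν_m`, injective, exhaustive out to `(3/2 + g) ν_m`), at `m′` ANY pattern `P′ ∈ {fcc, hcp}` with frame `A′ ≈ Q′` — and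
`m′ = f u` the site at a BASAL position `u` of `m` (`u ∈ hcpTwoShellPattern`, `u₀ + u₁ + u₂ = 0`).  Then
* (A) `P′ = hcpTwoShellPattern`: **the basal neighbours of an h-site are h-sites**;
* (B) `m = f′ x₀` for a basal `x₀`: **`m` lies in the basal plane of `m′`**;
* (C) **the layer normals agree**: the two frames carry the eclipsed-pair vector `a = (4,4,4)/√18` (`‖a‖² = 8/3`; `a/‖a‖` = the layer normal) to the
  same physical vector up to the mirror gauge sign of the hcp pattern, `‖ν_m A a ∓ ν_{m′} A′ a‖ ≤ 2·10⁻⁴ (ν_m + ν_{m′})`, hence `‖Q a ∓ Q′ a‖ ≤ 1/100`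
  (`basal_step_axis`; computed `0.0098`);
* (D) the scales agree, `0.9967 ν_m ≤ ν_{m′} ≤ 1.0011 ν_m` (the tree's `affFramed_scale_transfer_record` / `nearestDist_le_of_dist_le`).
NO DATUM, NO PIVOT, NO RADIUS: only the two sites' own `AffFramed (10⁻⁴, 10⁻³, 1/450)` charts enter — so the h-letter and the layer normal propagate
along every basal bond inside any affinely deep-registered region, in particular through the annulus `15.7 ν – 24 ν` of a rigid-run site, where the
re-based layer-rigidity atlas (`…RunCutRebase`, reach `15.7 ν`) establishes nothing (memo §10.8: this is what makes the h-sheets of the `24 ν` ball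
COMPLETE hexagonal nets — the input of the discrete crossing exclusion `…RunCutSheetCross` + `…RunCutCrossLocal`).

MECHANISM.  The two CAP SITES `q₁, q₂` of `m`'s pattern above and below a basal triangle at `u` (`…SheetLetterA.hcpTwoShellPattern_basal_cap_pair`:
unit pattern vectors `w₁, w₂` at contact distance from `u`, `w₁ − w₂ = a`) lie at distance `(1 ± 0.0022) ν_m` from `m′`, so `m′`'s chart (exhaustive to
`1.502 ν_{m′}`, `ν_{m′} ≥ 0.9967 ν_m`) matches them, and `m`, by pattern vectors `x₁, x₂, x₀`.  Reading the physical distances `|q₁q₂| = ‖a‖ ν_m ± 0.22 %`,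
`|q_i m| = ν_m ± 0.11 %` in `m′`'s chart (`…CrossRound.chart_pair_dist`, `chart_centre_dist`) squeezes `dist(x₁,x₂)² ∈ [2.646, 2.7]` and
`dist(x_i,x₀)² ∈ [0.99, 1.014]`; the finite facts decide: no fcc pair has `dist² ∈ (5/2, 3)` (`…AxisFingerprint` (b)) ⇒ (A); an hcp pair there is an
eclipsed pair `x₁ − x₂ = ±a` ((a)) ⇒ (C) by comparing the two charts' displacement readings of `q₁ − q₂` (`chart_pair_disp`); hcp `dist²` near `1` is `1`
((f)) and a point at contact distance from both ends of an eclipsed pair is basal ((e)) ⇒ (B).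
[this file: 0 definitions, 8 theorems; imports tree `…CompressedCutEstablish` and `…RunCutCrossRound` (p854541) and the staged part 16A `…RunCutSheetLetterA`;
standard axioms]
-/

namespace Summit.AtomisticToContinuum.Crystallization.Theorems.OverbindingBudgetAffineRunCutSheetLetter

open Literature.Geometry.DiscreteGeometry
open Summit.AtomisticToContinuum.Crystallization.Theorems.OverbindingBudgetAffineRunCutAxisFingerprint
open Summit.AtomisticToContinuum.Crystallization.Theorems.OverbindingBudgetAffineRunCutSheetLetterA
open Summit.AtomisticToContinuum.Crystallization.Theorems.OverbindingBudgetAffineRunCutCrossRound (chart_pair_dist)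
open Summit.AtomisticToContinuum.Crystallization.Theorems.OverbindingBudgetAffineCompressedCutScale (affFramed_scale_transfer_record
  nearestDist_le_of_dist_le)
open Summit.AtomisticToContinuum.Crystallization.Theorems.OverbindingBudgetAffineCompressedCutEstablish (nearestDist_pos_of_frame)
open Summit.AtomisticToContinuum.Crystallization.Theorems.OverbindingBudgetAffineLadder (AffFramed)

variable {N : ℕ}

local notation "E3" => EuclideanSpace ℝ (Fin 3)

/-! ## §1 Chart lemmas -/

/-- ★ **Centre reading.**  A site `a` matched (radius `η ν`) to the pattern vector `v` of a chart with centre `c`, scale `ν ≥ 0` and a frame `A`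
that is `θ`-close to the linear isometry `Q` at `v` lies at distance `ν‖v‖ ± (θ + η)ν` from the centre. [this file · kind: proof] -/
theorem chart_centre_dist {Q : E3 →ₗᵢ[ℝ] E3} {A : E3 →ₗ[ℝ] E3} {c a v : E3} {ν θ η : ℝ} (hν : 0 ≤ ν)
    (hv : ‖A v - Q v‖ ≤ θ) (ha : dist a (c + ν • A v) ≤ η * ν) :
    |dist a c - ν * ‖v‖| ≤ (θ + η) * ν := by
  have h1 : dist (c + ν • A v) c = ν * ‖A v‖ := by
    rw [dist_eq_norm, add_sub_cancel_left, norm_smul, Real.norm_of_nonneg hν]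
  have h2 : |‖A v‖ - ‖v‖| ≤ θ := by
    rw [← Q.norm_map v]; exact (abs_norm_sub_norm_le (A v) (Q v)).trans hv
  have h3 : |dist a c - dist (c + ν • A v) c| ≤ dist a (c + ν • A v) := by
    rw [abs_le]; constructor
    · linarith [dist_triangle (c + ν • A v) a c, dist_comm a (c + ν • A v)]
    · linarith [dist_triangle a (c + ν • A v) c]
  have h4 : |dist (c + ν • A v) c - ν * ‖v‖| ≤ θ * ν := by
    rw [h1, ← mul_sub, abs_mul, abs_of_nonneg hν]
    calc ν * |‖A v‖ - ‖v‖| ≤ ν * θ := mul_le_mul_of_nonneg_left h2 hν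
      _ = θ * ν := by ring
  calc |dist a c - ν * ‖v‖| = |(dist a c - dist (c + ν • A v) c) + (dist (c + ν • A v) c - ν * ‖v‖)| := by ring_nf
    _ ≤ |dist a c - dist (c + ν • A v) c| + |dist (c + ν • A v) c - ν * ‖v‖| := abs_add_le _ _
    _ ≤ η * ν + θ * ν := add_le_add (h3.trans ha) h4
    _ = (θ + η) * ν := by ring

/-- **Pair displacement.**  Two sites `a, b` matched to `v, w` in one chart: `‖(a − b) − ν·A (v − w)‖ ≤ 2ην`. [this file · kind: glue] -/
theorem chart_pair_disp {A : E3 →ₗ[ℝ] E3} {c a b v w : E3} {ν η : ℝ}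
    (ha : dist a (c + ν • A v) ≤ η * ν) (hb : dist b (c + ν • A w) ≤ η * ν) :
    ‖(a - b) - ν • A (v - w)‖ ≤ 2 * η * ν := by
  have e : (a - b) - ν • A (v - w) = (a - (c + ν • A v)) - (b - (c + ν • A w)) := by
    rw [map_sub, smul_sub]; abel
  rw [e]
  rw [dist_eq_norm] at ha hb
  calc ‖(a - (c + ν • A v)) - (b - (c + ν • A w))‖ ≤ ‖a - (c + ν • A v)‖ + ‖b - (c + ν • A w)‖ := norm_sub_le _ _
    _ ≤ η * ν + η * ν := add_le_add ha hb
    _ = 2 * η * ν := by ring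

/-- **Axis comparison, isometry form** (the arithmetic of `basal_step_axis`): from `‖ν b − ν′ b′‖ ≤ 2·10⁻⁴(ν + ν′)`, `‖b − p‖, ‖b′ − p′‖ ≤ 2·10⁻³`,
`‖p′‖ ≤ 1.633`, the scale window `0.9967ν ≤ ν′ ≤ 1.0011ν` and `ν > 0`: `‖p − p′‖ ≤ 1/100` (`= 0.0098` at worst). [this file · kind: glue] -/
theorem axis_arith {b p b' p' : E3} {ν ν' : ℝ} (hν : 0 < ν) (hlo : 9967 / 10000 * ν ≤ ν') (hhi : ν' ≤ (1 + 1 / 1000 + 1 / 10 ^ 4) * ν)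
    (h1 : ‖ν • b - ν' • b'‖ ≤ 2 / 10 ^ 4 * (ν + ν')) (h2 : ‖b - p‖ ≤ 2 / 1000) (h3 : ‖b' - p'‖ ≤ 2 / 1000)
    (h4 : ‖p'‖ ≤ 1633 / 1000) : ‖p - p'‖ ≤ 1 / 100 := by
  have key : ν • (p - p') = (ν • b - ν' • b') - ν • (b - p) + ν' • (b' - p') + (ν' - ν) • p' := by
    simp only [smul_sub, sub_smul]; abel
  have hν' : 0 ≤ ν' := by linarith
  have habs : |ν' - ν| ≤ 33 / 10000 * ν := by rw [abs_le]; constructor <;> linarith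
  have t2 : ‖ν • (b - p)‖ ≤ ν * (2 / 1000) := by
    rw [norm_smul, Real.norm_of_nonneg hν.le]; exact mul_le_mul_of_nonneg_left h2 hν.le
  have t3 : ‖ν' • (b' - p')‖ ≤ ν' * (2 / 1000) := by
    rw [norm_smul, Real.norm_of_nonneg hν']; exact mul_le_mul_of_nonneg_left h3 hν'
  have t4 : ‖(ν' - ν) • p'‖ ≤ 33 / 10000 * ν * (1633 / 1000) := by
    rw [norm_smul, Real.norm_eq_abs]; exact mul_le_mul habs h4 (norm_nonneg _) (by positivity)
  have hsum : ‖ν • (p - p')‖ ≤ 2 / 10 ^ 4 * (ν + ν') + ν * (2 / 1000) + ν' * (2 / 1000) + 33 / 10000 * ν * (1633 / 1000) := by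
    rw [key]
    calc ‖(ν • b - ν' • b') - ν • (b - p) + ν' • (b' - p') + (ν' - ν) • p'‖
          ≤ ‖(ν • b - ν' • b') - ν • (b - p) + ν' • (b' - p')‖ + ‖(ν' - ν) • p'‖ := norm_add_le _ _
      _ ≤ ‖(ν • b - ν' • b') - ν • (b - p)‖ + ‖ν' • (b' - p')‖ + ‖(ν' - ν) • p'‖ := by
          linarith [norm_add_le ((ν • b - ν' • b') - ν • (b - p)) (ν' • (b' - p'))]
      _ ≤ ‖ν • b - ν' • b'‖ + ‖ν • (b - p)‖ + ‖ν' • (b' - p')‖ + ‖(ν' - ν) • p'‖ := by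
          linarith [norm_sub_le (ν • b - ν' • b') (ν • (b - p))]
      _ ≤ _ := by linarith
  rw [norm_smul, Real.norm_of_nonneg hν.le] at hsum
  have h5 : ν * ‖p - p'‖ ≤ ν * (1 / 100) := by nlinarith
  exact le_of_mul_le_mul_left h5 hν

/-! ## §2 The basal step -/

section BasalStep

/-! The chart data of the section: an h-chart `(Q, A, f)` at `m`, any chart `(P′, Q′, A′, f′)` at `m′`, and `m′ = f u` at a basal position `u` of `m`. -/
variable {y : Fin N → E3} (hy : Function.Injective y) {m m' : Fin N}
  {Q : E3 →ₗᵢ[ℝ] E3} {A : E3 →ₗ[ℝ] E3} {f : E3 → E3}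
  (hA : ∀ v ∈ hcpTwoShellPattern, ‖A v - Q v‖ ≤ 1 / 1000)
  (hf : ∀ v ∈ hcpTwoShellPattern, f v ∈ Set.range y ∧ dist (f v) (y m + nearestDist y m • A v) ≤ 1 / 10 ^ 4 * nearestDist y m)
  (hinj : Set.InjOn f ↑hcpTwoShellPattern)
  (hex : ∀ k : Fin N, k ≠ m → dist (y k) (y m) ≤ (3 / 2 + 1 / 450) * nearestDist y m → ∃ v ∈ hcpTwoShellPattern, f v = y k)
  {P' : Finset E3} {Q' : E3 →ₗᵢ[ℝ] E3} {A' : E3 →ₗ[ℝ] E3} {f' : E3 → E3}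
  (hP' : P' = fccTwoShellPattern ∨ P' = hcpTwoShellPattern)
  (hA' : ∀ v ∈ P', ‖A' v - Q' v‖ ≤ 1 / 1000)
  (hf' : ∀ v ∈ P', f' v ∈ Set.range y ∧ dist (f' v) (y m' + nearestDist y m' • A' v) ≤ 1 / 10 ^ 4 * nearestDist y m')
  (hinj' : Set.InjOn f' ↑P')
  (hex' : ∀ k : Fin N, k ≠ m' → dist (y k) (y m') ≤ (3 / 2 + 1 / 450) * nearestDist y m' → ∃ v ∈ P', f' v = y k)
  {u : E3} (hu : u ∈ hcpTwoShellPattern) (hu0 : u 0 + u 1 + u 2 = 0) (hmu : f u = y m')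

include hy hA hf hinj hex hP' hA' hf' hinj' hex' hu hu0 hmu

/-- ★★ **THE BASAL STEP (letter constancy along a basal bond; record form).**  For the chart data of the section: (A) `P′` is the hcp pattern —
`m′` is an h-site; (B) `m` sits at a basal position `x₀` of `m′`'s chart; (C) the two frames carry the eclipsed-pair vector `a = (4,4,4)/√18` to the
same physical vector up to sign, `‖ν_m A a ∓ ν_{m′} A′ a‖ ≤ 2·10⁻⁴ (ν_m + ν_{m′})`, and both frames are `2/1000`-close to their isometries at `a`;
(D) `0.9967 ν_m ≤ ν_{m′} ≤ 1.0011 ν_m`.  No datum, no pivot: pointwise affine registration only (mechanism in the module docstring). [this file · kind: proof] -/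
theorem basal_step_record :
    P' = hcpTwoShellPattern ∧
    (∃ x₀ ∈ hcpTwoShellPattern, x₀ 0 + x₀ 1 + x₀ 2 = 0 ∧ f' x₀ = y m) ∧
    (‖nearestDist y m • A ((Real.sqrt 18)⁻¹ • intVec ![4, 4, 4]) - nearestDist y m' • A' ((Real.sqrt 18)⁻¹ • intVec ![4, 4, 4])‖
        ≤ 2 / 10 ^ 4 * (nearestDist y m + nearestDist y m') ∨
      ‖nearestDist y m • A ((Real.sqrt 18)⁻¹ • intVec ![4, 4, 4]) + nearestDist y m' • A' ((Real.sqrt 18)⁻¹ • intVec ![4, 4, 4])‖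
        ≤ 2 / 10 ^ 4 * (nearestDist y m + nearestDist y m')) ∧
    ‖A ((Real.sqrt 18)⁻¹ • intVec ![4, 4, 4]) - Q ((Real.sqrt 18)⁻¹ • intVec ![4, 4, 4])‖ ≤ 2 / 1000 ∧
    ‖A' ((Real.sqrt 18)⁻¹ • intVec ![4, 4, 4]) - Q' ((Real.sqrt 18)⁻¹ • intVec ![4, 4, 4])‖ ≤ 2 / 1000 ∧
    9967 / 10000 * nearestDist y m ≤ nearestDist y m' ∧ nearestDist y m' ≤ (1 + 1 / 1000 + 1 / 10 ^ 4) * nearestDist y m := by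
  set ν := nearestDist y m with hνdef
  set ν' := nearestDist y m' with hν'def
  set a : E3 := (Real.sqrt 18)⁻¹ • intVec ![4, 4, 4] with hadef
  have hν : 0 < ν := nearestDist_pos_of_frame hy (Or.inr rfl) (fun v hv => (hf v hv).1) hinj
  -- the pattern data at `u`
  have hu1 : ‖u‖ = 1 := norm_eq_one_of_basal hu hu0
  obtain ⟨w₁, hw₁, w₂, hw₂, hn₁, hn₂, hd₁, hd₂, hww⟩ := hcpTwoShellPattern_basal_cap_pair hu hu0
  obtain ⟨haL, haU⟩ := norm_eclipsedVec_bounds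
  rw [← hadef] at haL haU hww
  -- the cap sites
  obtain ⟨k₁, hk₁⟩ := (hf w₁ hw₁).1
  obtain ⟨k₂, hk₂⟩ := (hf w₂ hw₂).1
  have e₁ : dist (y k₁) (y m + ν • A w₁) ≤ 1 / 10 ^ 4 * ν := by rw [hk₁]; exact (hf w₁ hw₁).2
  have e₂ : dist (y k₂) (y m + ν • A w₂) ≤ 1 / 10 ^ 4 * ν := by rw [hk₂]; exact (hf w₂ hw₂).2
  have eu : dist (y m') (y m + ν • A u) ≤ 1 / 10 ^ 4 * ν := by rw [← hmu]; exact (hf u hu).2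
  -- readings in the chart of `m`
  have Rm' := chart_centre_dist hν.le (hA u hu) eu
  rw [hu1, mul_one] at Rm'
  have R₁ := chart_centre_dist hν.le (hA w₁ hw₁) e₁
  rw [hn₁, mul_one] at R₁
  have R₂ := chart_centre_dist hν.le (hA w₂ hw₂) e₂
  rw [hn₂, mul_one] at R₂
  have R₁' := chart_pair_dist hν.le (hA w₁ hw₁) (hA u hu) e₁ eu
  rw [← dist_eq_norm, hd₁, mul_one] at R₁'
  have R₂' := chart_pair_dist hν.le (hA w₂ hw₂) (hA u hu) e₂ eu
  rw [← dist_eq_norm, hd₂, mul_one] at R₂'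
  have R₁₂ := chart_pair_dist hν.le (hA w₁ hw₁) (hA w₂ hw₂) e₁ e₂
  rw [hww] at R₁₂
  have D₁₂ := chart_pair_disp e₁ e₂
  rw [hww] at D₁₂
  rw [abs_le] at Rm' R₁ R₂ R₁' R₂' R₁₂
  have hνa : ν * ‖a‖ ≤ ν * (1633 / 1000) := mul_le_mul_of_nonneg_left haU hν.le
  have hνa' : ν * (16329 / 10000) ≤ ν * ‖a‖ := mul_le_mul_of_nonneg_left haL hν.le
  -- `m′ ≠ m`, the cap sites are not `m′`
  have hm'm : m' ≠ m := by
    intro h; rw [h, dist_self] at Rm'; linarith only [Rm'.1, hν]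
  have hk₁m' : k₁ ≠ m' := by
    intro h; rw [h, dist_self] at R₁'; linarith only [R₁'.1, hν]
  have hk₂m' : k₂ ≠ m' := by
    intro h; rw [h, dist_self] at R₂'; linarith only [R₂'.1, hν]
  -- the scale window
  have hFm : AffFramed (1 / 10 ^ 4) (1 / 1000) (1 / 450) y m := ⟨Q, A, hcpTwoShellPattern, f, Or.inr rfl, hA, hf, hinj, hex⟩
  have hFm' : AffFramed (1 / 10 ^ 4) (1 / 1000) (1 / 450) y m' := ⟨Q', A', P', f', hP', hA', hf', hinj', hex'⟩
  have hdm : dist (y m') (y m) ≤ (1 + 1 / 1000 + 1 / 10 ^ 4) * ν := by linarith only [Rm'.2]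
  have hlo : 9967 / 10000 * ν ≤ ν' := affFramed_scale_transfer_record hy hFm hFm' hm'm hdm
  have hhi : ν' ≤ (1 + 1 / 1000 + 1 / 10 ^ 4) * ν := nearestDist_le_of_dist_le hm'm hdm
  have hν' : 0 < ν' := by linarith only [hlo, hν]
  -- the three sites in the chart of `m′`
  obtain ⟨x₀, hx₀, hfx₀⟩ := hex' m hm'm.symm (by rw [dist_comm]; linarith only [Rm'.2, hlo, hν])
  obtain ⟨x₁, hx₁, hfx₁⟩ := hex' k₁ hk₁m' (by linarith only [R₁'.2, hlo, hν])
  obtain ⟨x₂, hx₂, hfx₂⟩ := hex' k₂ hk₂m' (by linarith only [R₂'.2, hlo, hν])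
  have e₀' : dist (y m) (y m' + ν' • A' x₀) ≤ 1 / 10 ^ 4 * ν' := by rw [← hfx₀]; exact (hf' x₀ hx₀).2
  have e₁' : dist (y k₁) (y m' + ν' • A' x₁) ≤ 1 / 10 ^ 4 * ν' := by rw [← hfx₁]; exact (hf' x₁ hx₁).2
  have e₂' : dist (y k₂) (y m' + ν' • A' x₂) ≤ 1 / 10 ^ 4 * ν' := by rw [← hfx₂]; exact (hf' x₂ hx₂).2
  -- readings in the chart of `m′`
  have S₁₂ := chart_pair_dist hν'.le (hA' x₁ hx₁) (hA' x₂ hx₂) e₁' e₂'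
  have S₁₀ := chart_pair_dist hν'.le (hA' x₁ hx₁) (hA' x₀ hx₀) e₁' e₀'
  have S₂₀ := chart_pair_dist hν'.le (hA' x₂ hx₂) (hA' x₀ hx₀) e₂' e₀'
  have D₁₂' := chart_pair_disp e₁' e₂'
  rw [abs_le] at S₁₂ S₁₀ S₂₀
  rw [← dist_eq_norm] at S₁₂ S₁₀ S₂₀
  -- windows for the three model distances
  have W₁₂U : ν' * dist x₁ x₂ ≤ ν' * (16429 / 10000) := by linarith only [S₁₂.1, R₁₂.2, hνa, hlo, hν']
  have W₁₂L : ν' * (16267 / 10000) ≤ ν' * dist x₁ x₂ := by linarith only [S₁₂.2, R₁₂.1, hνa', hhi, hν']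
  have W₁₀U : ν' * dist x₁ x₀ ≤ ν' * (10067 / 10000) := by linarith only [S₁₀.1, R₁.2, hlo, hν']
  have W₁₀L : ν' * (9956 / 10000) ≤ ν' * dist x₁ x₀ := by linarith only [S₁₀.2, R₁.1, hhi, hν']
  have W₂₀U : ν' * dist x₂ x₀ ≤ ν' * (10067 / 10000) := by linarith only [S₂₀.1, R₂.2, hlo, hν']
  have W₂₀L : ν' * (9956 / 10000) ≤ ν' * dist x₂ x₀ := by linarith only [S₂₀.2, R₂.1, hhi, hν']
  have sqU : ∀ {d c s : ℝ}, 0 ≤ d → d ≤ c → c * c ≤ s → d ^ 2 ≤ s := fun hd hdc hcs => by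
    rw [sq]; exact (mul_le_mul hdc hdc hd (hd.trans hdc)).trans hcs
  have sqL : ∀ {d c s : ℝ}, 0 ≤ c → c ≤ d → s ≤ c * c → s ≤ d ^ 2 := fun hc hcd hsc => by
    rw [sq]; exact hsc.trans (mul_le_mul hcd hcd hc (hc.trans hcd))
  have d₁₂U : dist x₁ x₂ ^ 2 ≤ 27 / 10 := sqU dist_nonneg (le_of_mul_le_mul_left W₁₂U hν') (by norm_num)
  have d₁₂L : (2646 / 1000 : ℝ) ≤ dist x₁ x₂ ^ 2 := sqL (by norm_num) (le_of_mul_le_mul_left W₁₂L hν') (by norm_num)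
  have d₁₀U : dist x₁ x₀ ^ 2 ≤ 1014 / 1000 := sqU dist_nonneg (le_of_mul_le_mul_left W₁₀U hν') (by norm_num)
  have d₁₀L : (99 / 100 : ℝ) ≤ dist x₁ x₀ ^ 2 := sqL (by norm_num) (le_of_mul_le_mul_left W₁₀L hν') (by norm_num)
  have d₂₀U : dist x₂ x₀ ^ 2 ≤ 1014 / 1000 := sqU dist_nonneg (le_of_mul_le_mul_left W₂₀U hν') (by norm_num)
  have d₂₀L : (99 / 100 : ℝ) ≤ dist x₂ x₀ ^ 2 := sqL (by norm_num) (le_of_mul_le_mul_left W₂₀L hν') (by norm_num)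
  -- (A) the pattern at `m′` is hcp
  have hPh : P' = hcpTwoShellPattern := by
    rcases hP' with h | h
    · exfalso
      rw [h] at hx₁ hx₂
      rcases fccTwoShellPattern_dist_sq_dichotomy x₁ hx₁ x₂ hx₂ with h5 | h5
      · linarith only [h5, d₁₂L]
      · linarith only [h5, d₁₂U]
    · exact h
  rw [hPh] at hx₀ hx₁ hx₂ hA'
  -- the pair `x₁, x₂` is an eclipsed pair, `x₀` a contact of both, hence basal
  have h83 : dist x₁ x₂ ^ 2 = 8 / 3 := by
    rcases hcpTwoShellPattern_dist_sq_trichotomy x₁ hx₁ x₂ hx₂ with h | h | h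
    · exact h
    · exfalso; linarith only [h, d₁₂L]
    · exfalso; linarith only [h, d₁₂U]
  have h01 : dist x₀ x₁ ^ 2 = 1 := by
    rw [dist_comm]
    rcases hcpTwoShellPattern_dist_sq_contact_trichotomy x₁ hx₁ x₀ hx₀ with h | h | h
    · exfalso; linarith only [h, d₁₀L]
    · exact h
    · exfalso; linarith only [h, d₁₀U]
  have h02 : dist x₀ x₂ ^ 2 = 1 := by
    rw [dist_comm]
    rcases hcpTwoShellPattern_dist_sq_contact_trichotomy x₂ hx₂ x₀ hx₀ with h | h | h
    · exfalso; linarith only [h, d₂₀L]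
    · exact h
    · exfalso; linarith only [h, d₂₀U]
  have hx₀0 : x₀ 0 + x₀ 1 + x₀ 2 = 0 := hcpTwoShellPattern_basal_of_eclipsed_contacts x₁ hx₁ x₂ hx₂ h83 x₀ hx₀ h01 h02
  -- (C) the axis
  have hAQ : ‖A a - Q a‖ ≤ 2 / 1000 := by
    rw [← hww, map_sub, map_sub]
    have e : A w₁ - A w₂ - (Q w₁ - Q w₂) = (A w₁ - Q w₁) - (A w₂ - Q w₂) := by abel
    rw [e]
    linarith only [norm_sub_le (A w₁ - Q w₁) (A w₂ - Q w₂), hA w₁ hw₁, hA w₂ hw₂]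
  have hAQ' : ∀ z₁ ∈ hcpTwoShellPattern, ∀ z₂ ∈ hcpTwoShellPattern, ‖A' (z₁ - z₂) - Q' (z₁ - z₂)‖ ≤ 2 / 1000 := by
    intro z₁ hz₁ z₂ hz₂
    rw [map_sub, map_sub]
    have e : A' z₁ - A' z₂ - (Q' z₁ - Q' z₂) = (A' z₁ - Q' z₁) - (A' z₂ - Q' z₂) := by abel
    rw [e]
    linarith only [norm_sub_le (A' z₁ - Q' z₁) (A' z₂ - Q' z₂), hA' z₁ hz₁, hA' z₂ hz₂]
  have hcmp : ‖ν • A a - ν' • A' (x₁ - x₂)‖ ≤ 2 / 10 ^ 4 * (ν + ν') := by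
    have e : ν • A a - ν' • A' (x₁ - x₂) = ((y k₁ - y k₂) - ν' • A' (x₁ - x₂)) - ((y k₁ - y k₂) - ν • A a) := by abel
    rw [e]
    calc ‖((y k₁ - y k₂) - ν' • A' (x₁ - x₂)) - ((y k₁ - y k₂) - ν • A a)‖
          ≤ ‖(y k₁ - y k₂) - ν' • A' (x₁ - x₂)‖ + ‖(y k₁ - y k₂) - ν • A a‖ := norm_sub_le _ _
      _ ≤ 2 * (1 / 10 ^ 4) * ν' + 2 * (1 / 10 ^ 4) * ν := add_le_add D₁₂' D₁₂
      _ = 2 / 10 ^ 4 * (ν + ν') := by ring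
  have haxis : (‖ν • A a - ν' • A' a‖ ≤ 2 / 10 ^ 4 * (ν + ν') ∨ ‖ν • A a + ν' • A' a‖ ≤ 2 / 10 ^ 4 * (ν + ν')) ∧
      ‖A' a - Q' a‖ ≤ 2 / 1000 := by
    rcases hcpTwoShellPattern_eclipsed_axis x₁ hx₁ x₂ hx₂ h83 with hx | hx
    · rw [hx] at hcmp
      exact ⟨Or.inl hcmp, by rw [hadef, ← hx]; exact hAQ' x₁ hx₁ x₂ hx₂⟩
    · have hx' : x₁ - x₂ = -a := by rw [← neg_sub, hx]
      rw [hx', map_neg, smul_neg, sub_neg_eq_add] at hcmp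
      exact ⟨Or.inr hcmp, by rw [hadef, ← hx]; exact hAQ' x₂ hx₂ x₁ hx₁⟩
  exact ⟨hPh, ⟨x₀, hx₀, hx₀0, hfx₀⟩, haxis.1, hAQ, haxis.2, hlo, hhi⟩


/-- ★ (A) **The basal neighbours of an h-site are h-sites.** [this file · kind: proof] -/
theorem basal_step_hcp : P' = hcpTwoShellPattern :=
  (basal_step_record hy hA hf hinj hex hP' hA' hf' hinj' hex' hu hu0 hmu).1

/-- ★ (B) **An h-site lies in the basal plane of each of its basal neighbours**: `m = f′ x₀` with `x₀` basal. [this file · kind: proof] -/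
theorem basal_step_back : ∃ x₀ ∈ hcpTwoShellPattern, x₀ 0 + x₀ 1 + x₀ 2 = 0 ∧ f' x₀ = y m :=
  (basal_step_record hy hA hf hinj hex hP' hA' hf' hinj' hex' hu hu0 hmu).2.1

/-- ★ (C) **The layer normals of an h-site and of its basal neighbour agree** (isometry form, up to the mirror gauge sign of the hcp pattern):
`‖Q a − Q′ a‖ ≤ 1/100` or `‖Q a + Q′ a‖ ≤ 1/100` for the eclipsed-pair vector `a = (4,4,4)/√18` (`‖a‖ = 1.633`). [this file · kind: proof] -/
theorem basal_step_axis :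
    ‖Q ((Real.sqrt 18)⁻¹ • intVec ![4, 4, 4]) - Q' ((Real.sqrt 18)⁻¹ • intVec ![4, 4, 4])‖ ≤ 1 / 100 ∨
      ‖Q ((Real.sqrt 18)⁻¹ • intVec ![4, 4, 4]) + Q' ((Real.sqrt 18)⁻¹ • intVec ![4, 4, 4])‖ ≤ 1 / 100 := by
  obtain ⟨-, -, hax, hAQ, hAQ', hlo, hhi⟩ := basal_step_record hy hA hf hinj hex hP' hA' hf' hinj' hex' hu hu0 hmu
  set a : E3 := (Real.sqrt 18)⁻¹ • intVec ![4, 4, 4] with hadef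
  have hν : 0 < nearestDist y m := nearestDist_pos_of_frame hy (Or.inr rfl) (fun v hv => (hf v hv).1) hinj
  have hQ'a : ‖Q' a‖ ≤ 1633 / 1000 := by rw [Q'.norm_map]; exact norm_eclipsedVec_bounds.2
  rcases hax with h | h
  · exact Or.inl (axis_arith hν hlo hhi h hAQ hAQ' hQ'a)
  · right
    have h' : ‖nearestDist y m • A a - nearestDist y m' • (-(A' a))‖ ≤ 2 / 10 ^ 4 * (nearestDist y m + nearestDist y m') := by
      rwa [smul_neg, sub_neg_eq_add]
    have hAQ'' : ‖-(A' a) - -(Q' a)‖ ≤ 2 / 1000 := by rwa [neg_sub_neg, norm_sub_rev]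
    have hQ'a' : ‖-(Q' a)‖ ≤ 1633 / 1000 := by rwa [norm_neg]
    have := axis_arith hν hlo hhi h' hAQ hAQ'' hQ'a'
    rwa [sub_neg_eq_add] at this

/-- (D) **The scales of an h-site and of its basal neighbour agree**: `0.9967 ν_m ≤ ν_{m′} ≤ 1.0011 ν_m`. [this file · kind: glue] -/
theorem basal_step_scale :
    9967 / 10000 * nearestDist y m ≤ nearestDist y m' ∧ nearestDist y m' ≤ (1 + 1 / 1000 + 1 / 10 ^ 4) * nearestDist y m :=
  (basal_step_record hy hA hf hinj hex hP' hA' hf' hinj' hex' hu hu0 hmu).2.2.2.2.2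

end BasalStep

end Summit.AtomisticToContinuum.Crystallization.Theorems.OverbindingBudgetAffineRunCutSheetLetter
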